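import Summits.KontsevichZagierPeriods.KontsevichZagierPeriods.Theorems.K2SymbolChainsFigureEightIsTwoSmythAlgebra
import Literature.NumberTheory.Transcendental.KZTorusLogRep

/-!
# `FigureEightIsTwoSmyth`: the two torus representations exist (helper)

Item stmt-KontsevichZagierPeriods-5203 of route K2SymbolChains quantifies over all
`r r' : KZ.IntegralRep 3` with prescribed domains and integrands-on-the-domain: the unfolded torus
representations of `M(A_{4₁})` (`|A| = |16c⁴ − 20c² + 2 − 2cos φ|` on the torus, `c = cos θ`) and
of `2·M(1+x+y)`. By `figureEightIsTwoSmyth_of_exists` (file `K2SymbolChainsFigureEightIsTwoSmyth`)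
one pair suffices, and this file BUILDS the pair as honest representations of the fixed calculus
(`exists_torusRepA`, `exists_torusRepB`), with the item's domains and integrands DEFINITIONALLY.
The only analytic input is absolute convergence of Mahler measures, imported through
`KZ.torusLogRep` / `KZ.integrableOn_torusWeight_mul_log_torusNormSq` (`KZTorusLogRep.lean`):

* side A: the torus polynomial `P_A = y(x⁸ + 1 − x⁶ − x² − 2x⁴) − x⁴y² − x⁴ = x⁴·y·A(y, x)` of the
  figure-eight A-polynomial `A(L,M) = M⁴+M⁻⁴−M²−M⁻²−2−L−L⁻¹` (`x = M = e(t)`, `y = L = e(s)`)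
  satisfies `|P_A(e(t), e(s))|² = (16c⁴ − 20c² + 2 − 2c(s))²` (`torusNormSq_figureEightPoly`;
  on the torus `A = x⁴ + x̄⁴ − x² − x̄² − 2 − y − ȳ` is real), so the item's fibre bound is a
  `KZ.torusNormSq` and `h_A · log F²` is integrable on `ℝ²` (`integrable_weightA_mul_log`);
* side B: `|1 + e(t) + e(s)|²` is `KZ.torusNormSq (1 + X 0 + X 1)` verbatim
  (`KZ.torusNormSq_one_add_X_add_X`), the weight being doubled.

Also recorded for the later files of the chain: semialgebraicity of the weights and fibre
bounds, the null set `{F = 0}`, and integrability of the bare weight `2/((1+t²)(1+s²))` on `ℝ²`.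
No new definitions (the data are spelled out, as in the item).
-/

-- single-conjunct summit: Sub = Summit, so the namespace segment repeats by design (CONVENTIONS §2)
set_option linter.dupNamespace false

noncomputable section

open MeasureTheory Set MvPolynomial
open Literature.NumberTheory.Transcendental Literature.ModelTheory.ExponentialFields
open Literature.NumberTheory.Transcendental.KZ
open scoped ComplexConjugate

namespace Summit.KontsevichZagierPeriods.KontsevichZagierPeriods.Theorems

/-! ### Side A: the torus polynomial of the figure-eight A-polynomial -/

/-- `e(t) · conj e(t) = 1` for the rational parametrisation of the circle. [folklore] -/
theorem ratCircle_mul_conj (t : ℝ) : ratCircle t * conj (ratCircle t) = 1 := by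
  rw [Complex.mul_conj, Complex.normSq_eq_norm_sq, norm_ratCircle]; simp

/-- **The torus factorisation `P_A = x⁴ y · A`.** On the torus `x = e(t)`, `y = e(s)` the
polynomial `P_A = y(x⁸ + 1 − x⁶ − x² − 2x⁴) − x⁴y² − x⁴` equals
`x⁴ y (x⁴ + x̄⁴ − x² − x̄² − 2 − y − ȳ)`, i.e. `x⁴ y · A(y, x)` with `x⁻¹ = x̄`, `y⁻¹ = ȳ`
(`A(L,M) = M⁴+M⁻⁴−M²−M⁻²−2−L−L⁻¹`, the A-polynomial of `4₁`). [Boyd 2002; folklore] -/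
theorem torusEval_figureEightPoly (b : Fin 2 → ℝ) :
    torusEval (X 1 * (X 0 ^ 8 + 1 - X 0 ^ 6 - X 0 ^ 2 - 2 * X 0 ^ 4) - X 0 ^ 4 * X 1 ^ 2 - X 0 ^ 4 :
      MvPolynomial (Fin 2) ℚ) b =
      ratCircle (b 0) ^ 4 * ratCircle (b 1) *
        (ratCircle (b 0) ^ 4 + conj (ratCircle (b 0)) ^ 4 - ratCircle (b 0) ^ 2 -
          conj (ratCircle (b 0)) ^ 2 - 2 - ratCircle (b 1) - conj (ratCircle (b 1))) := by
  have hx := ratCircle_mul_conj (b 0)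
  have hy := ratCircle_mul_conj (b 1)
  simp only [torusEval_def, map_sub, map_mul, map_add, map_pow, aeval_X, map_one, map_ofNat]
  set x := ratCircle (b 0)
  set y := ratCircle (b 1)
  linear_combination (-(y * ((x * conj x) ^ 3 + (x * conj x) ^ 2 + x * conj x + 1)) +
    x ^ 2 * y * (x * conj x + 1)) * hx + x ^ 4 * hy

/-- **`A` is real on the torus**: `x⁴ + x̄⁴ − x² − x̄² − 2 − y − ȳ = 16c⁴ − 20c² + 2 − 2c(s)`
(`c = Re e(t) = cos θ`, `c(s) = Re e(s) = cos φ`; `2cos 4θ − 2cos 2θ − 2 − 2cos φ`).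
[Boyd 2002; folklore] -/
theorem figureEight_bracket_eq_ofReal (b : Fin 2 → ℝ) :
    (ratCircle (b 0) ^ 4 + conj (ratCircle (b 0)) ^ 4 - ratCircle (b 0) ^ 2 -
          conj (ratCircle (b 0)) ^ 2 - 2 - ratCircle (b 1) - conj (ratCircle (b 1))) =
      ((16 * ((1 - b 0 ^ 2) / (1 + b 0 ^ 2)) ^ 4 - 20 * ((1 - b 0 ^ 2) / (1 + b 0 ^ 2)) ^ 2 + 2 -
        2 * (1 - b 1 ^ 2) / (1 + b 1 ^ 2) : ℝ) : ℂ) := by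
  apply Complex.ext
  · simp only [Complex.sub_re, Complex.add_re, Complex.ofReal_re, Complex.conj_re, Complex.conj_im,
      pow_succ, pow_zero, one_mul, Complex.mul_re, Complex.mul_im, ratCircle_re, ratCircle_im,
      Complex.re_ofNat]
    have h0 : (1 + b 0 ^ 2 : ℝ) ≠ 0 := by positivity
    have h1 : (1 + b 1 ^ 2 : ℝ) ≠ 0 := by positivity
    field_simp
    ring
  · simp only [Complex.sub_im, Complex.add_im, Complex.ofReal_im, Complex.conj_re, Complex.conj_im,
      pow_succ, pow_zero, one_mul, Complex.mul_re, Complex.mul_im, ratCircle_re, ratCircle_im,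
      Complex.im_ofNat]
    ring

/-- **The item's fibre bound is a torus norm**: `|P_A(e(t), e(s))|² = (16c⁴ − 20c² + 2 − 2c(s))²`,
the square of the (real) value of the figure-eight A-polynomial on the torus, `c = (1−t²)/(1+t²)`.
[Boyd 2002; Boyd–Rodriguez-Villegas 2005; folklore] -/
theorem torusNormSq_figureEightPoly (b : Fin 2 → ℝ) :
    torusNormSq (X 1 * (X 0 ^ 8 + 1 - X 0 ^ 6 - X 0 ^ 2 - 2 * X 0 ^ 4) - X 0 ^ 4 * X 1 ^ 2 - X 0 ^ 4 :
      MvPolynomial (Fin 2) ℚ) b =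
      (16 * ((1 - b 0 ^ 2) / (1 + b 0 ^ 2)) ^ 4 - 20 * ((1 - b 0 ^ 2) / (1 + b 0 ^ 2)) ^ 2 + 2 -
        2 * (1 - b 1 ^ 2) / (1 + b 1 ^ 2)) ^ 2 := by
  rw [torusNormSq_eq_norm_sq, torusEval_figureEightPoly, figureEight_bracket_eq_ofReal, norm_mul,
    norm_mul, norm_pow, norm_ratCircle, norm_ratCircle, one_pow, one_mul, one_mul, Complex.norm_real,
    Real.norm_eq_abs, sq_abs]

/-- `P_A ≠ 0` (its value at `t = s = 0`, i.e. `x = y = 1`, is `−4`). [folklore] -/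
theorem figureEightPoly_ne_zero :
    (X 1 * (X 0 ^ 8 + 1 - X 0 ^ 6 - X 0 ^ 2 - 2 * X 0 ^ 4) - X 0 ^ 4 * X 1 ^ 2 - X 0 ^ 4 :
      MvPolynomial (Fin 2) ℚ) ≠ 0 := by
  intro h
  have h' := congr_arg (torusNormSq · (fun _ : Fin 2 => (0 : ℝ))) h
  simp only [torusNormSq_figureEightPoly] at h'
  norm_num [torusNormSq, torusEval_def] at h'

/-- The weight of the two-dimensional unfolded torus representations:
`torusWeight (t, s) = 2/((1+t²)(1+s²))`. [Kontsevich–Zagier 2001, §1.1] [folklore] -/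
theorem torusWeight_fin_two (b : Fin 2 → ℝ) : torusWeight b = 2 / ((1 + b 0 ^ 2) * (1 + b 1 ^ 2)) := by
  rw [torusWeight_def, Fin.prod_univ_two]
  rw [show (2 : ℝ) ^ 2 = 2 * 2 by norm_num, mul_div_mul_left _ _ (two_ne_zero' ℝ)]

/-- `torusWeight · log |P(e)|²` is integrable on `ℝ²` for `P ≠ 0`, in the coordinates of the item.
[Bombieri–Gubler 2006, §1.6; folklore] -/
theorem integrable_weight_mul_log_torusNormSq {P : MvPolynomial (Fin 2) ℚ} (hP : P ≠ 0) :
    Integrable fun b : Fin 2 → ℝ => 2 / ((1 + b 0 ^ 2) * (1 + b 1 ^ 2)) * Real.log (torusNormSq P b) := by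
  have h := integrableOn_torusWeight_mul_log_torusNormSq P
  have huniv : {_x : Fin 2 → ℝ | P ≠ 0} = univ := eq_univ_of_forall fun _ => hP
  rw [huniv, integrableOn_univ] at h
  refine h.congr (ae_of_all _ fun b => ?_)
  simp only [torusWeight_fin_two]

/-- **Side A converges absolutely**: `h_A · log F²`, `h_A = 2/((1+t²)(1+s²))`,
`F = 16c⁴ − 20c² + 2 − 2c(s)`, is integrable on `ℝ²` (Mahler measure of `P_A`). [Boyd 2002; folklore] -/
theorem integrable_weightA_mul_log :
    Integrable fun b : Fin 2 → ℝ => 2 / ((1 + b 0 ^ 2) * (1 + b 1 ^ 2)) *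
      Real.log ((16 * ((1 - b 0 ^ 2) / (1 + b 0 ^ 2)) ^ 4 - 20 * ((1 - b 0 ^ 2) / (1 + b 0 ^ 2)) ^ 2 + 2 -
        2 * (1 - b 1 ^ 2) / (1 + b 1 ^ 2)) ^ 2) := by
  simpa only [torusNormSq_figureEightPoly] using
    integrable_weight_mul_log_torusNormSq figureEightPoly_ne_zero

/-- **Side B converges absolutely**: `h_B · log |1 + e(t) + e(s)|²`, `h_B = 4/((1+t²)(1+s²))`, is
integrable on `ℝ²` (Mahler measure of `1 + x + y`, doubled). [Smyth 1981; folklore] -/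
theorem integrable_weightB_mul_log :
    Integrable fun b : Fin 2 → ℝ => 4 / ((1 + b 0 ^ 2) * (1 + b 1 ^ 2)) *
      Real.log ((1 + (1 - b 0 ^ 2) / (1 + b 0 ^ 2) + (1 - b 1 ^ 2) / (1 + b 1 ^ 2)) ^ 2 +
        (2 * b 0 / (1 + b 0 ^ 2) + 2 * b 1 / (1 + b 1 ^ 2)) ^ 2) := by
  have h := (integrable_weight_mul_log_torusNormSq one_add_X_add_X_ne_zero).const_mul 2
  refine h.congr (ae_of_all _ fun b => ?_)
  simp only [torusNormSq_one_add_X_add_X]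
  ring

/-- **The bare weight `2/((1+t²)(1+s²))` is integrable on `ℝ²`** (total mass `2π²`; obtained
here from the constant polynomial `P = 2`, `|P|² = 4`). [folklore] -/
theorem integrable_weightA : Integrable fun b : Fin 2 → ℝ => 2 / ((1 + b 0 ^ 2) * (1 + b 1 ^ 2)) := by
  have hP : (C 2 : MvPolynomial (Fin 2) ℚ) ≠ 0 := by simp
  have h := (integrable_weight_mul_log_torusNormSq hP).div_const (Real.log 4)
  refine h.congr (ae_of_all _ fun b => ?_)
  have h4 : Real.log 4 ≠ 0 := by positivity
  have hW : torusNormSq (C 2 : MvPolynomial (Fin 2) ℚ) b = 4 := by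
    norm_num [torusNormSq, torusEval_def]
  simp only [hW]
  field_simp

/-! ### Semialgebraicity of the data -/

/-- `c(b i) = (1 − bᵢ²)/(1 + bᵢ²)` is `ℚ`-semialgebraic on any `ℚ`-semialgebraic `S`. [BCR 1998, §2.2]
[folklore] -/
theorem isSemialgebraicFunOn_ratCos {m : ℕ} {S : Set (Fin m → ℝ)} (hS : IsSemialgebraic ℚ S)
    (i : Fin m) : IsSemialgebraicFunOn ℚ S fun b => (1 - b i ^ 2) / (1 + b i ^ 2) :=
  ((isSemialgebraicFunOn_ratCircle_re i).mono (subset_univ S) hS).congr fun b _ => by simp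

/-- `σ(b i) = 2bᵢ/(1 + bᵢ²)` is `ℚ`-semialgebraic on any `ℚ`-semialgebraic `S`. [BCR 1998, §2.2]
[folklore] -/
theorem isSemialgebraicFunOn_ratSin {m : ℕ} {S : Set (Fin m → ℝ)} (hS : IsSemialgebraic ℚ S)
    (i : Fin m) : IsSemialgebraicFunOn ℚ S fun b => 2 * b i / (1 + b i ^ 2) :=
  ((isSemialgebraicFunOn_ratCircle_im i).mono (subset_univ S) hS).congr fun b _ => by simp

/-- The weight `q/((1+t²)(1+s²))` (`q ∈ ℚ`) is `ℚ`-semialgebraic on any `ℚ`-semialgebraic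
`S ⊆ ℝ²`. [BCR 1998, §2.2] [folklore] -/
theorem isSemialgebraicFunOn_weight {S : Set (Fin 2 → ℝ)} (hS : IsSemialgebraic ℚ S) (q : ℚ) :
    IsSemialgebraicFunOn ℚ S fun b => (q : ℝ) / ((1 + b 0 ^ 2) * (1 + b 1 ^ 2)) := by
  refine (isSemialgebraicFunOn_aeval_div_aeval hS (C q) ((1 + X 0 ^ 2) * (1 + X 1 ^ 2))
    fun b _ => ?_).congr fun b _ => by simp
  have : (0 : ℝ) < (1 + b 0 ^ 2) * (1 + b 1 ^ 2) := by positivity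
  simpa using this.ne'

/-- The fibre bound `F² = (16c⁴ − 20c² + 2 − 2c(s))²` of side A is `ℚ`-semialgebraic on any
`ℚ`-semialgebraic `S ⊆ ℝ²` (it is `KZ.torusNormSq P_A`). [BCR 1998, §2.2] [folklore] -/
theorem isSemialgebraicFunOn_boundA {S : Set (Fin 2 → ℝ)} (hS : IsSemialgebraic ℚ S) :
    IsSemialgebraicFunOn ℚ S fun b => (16 * ((1 - b 0 ^ 2) / (1 + b 0 ^ 2)) ^ 4 -
      20 * ((1 - b 0 ^ 2) / (1 + b 0 ^ 2)) ^ 2 + 2 - 2 * (1 - b 1 ^ 2) / (1 + b 1 ^ 2)) ^ 2 :=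
  (((isSemialgebraicFunOn_torusNormSq _).mono (subset_univ S) hS)).congr fun b _ =>
    torusNormSq_figureEightPoly b

/-- The fibre bound `|1 + e(t) + e(s)|²` of side B is `ℚ`-semialgebraic on any `ℚ`-semialgebraic
`S ⊆ ℝ²`. [BCR 1998, §2.2] [folklore] -/
theorem isSemialgebraicFunOn_boundB {S : Set (Fin 2 → ℝ)} (hS : IsSemialgebraic ℚ S) :
    IsSemialgebraicFunOn ℚ S fun b => (1 + (1 - b 0 ^ 2) / (1 + b 0 ^ 2) + (1 - b 1 ^ 2) / (1 + b 1 ^ 2)) ^ 2 +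
      (2 * b 0 / (1 + b 0 ^ 2) + 2 * b 1 / (1 + b 1 ^ 2)) ^ 2 :=
  (((isSemialgebraicFunOn_torusNormSq _).mono (subset_univ S) hS)).congr fun b _ =>
    torusNormSq_one_add_X_add_X b

/-- `{F = 0}` is null in `ℝ²` (zeros of `P_A` on the torus). [folklore] -/
theorem volume_boundA_eq_zero :
    volume {b : Fin 2 → ℝ | b ∈ (univ : Set (Fin 2 → ℝ)) ∧ (16 * ((1 - b 0 ^ 2) / (1 + b 0 ^ 2)) ^ 4 -
      20 * ((1 - b 0 ^ 2) / (1 + b 0 ^ 2)) ^ 2 + 2 - 2 * (1 - b 1 ^ 2) / (1 + b 1 ^ 2)) ^ 2 = 0} = 0 := by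
  have h := volume_sep_torusNormSq_eq_zero
    (X 1 * (X 0 ^ 8 + 1 - X 0 ^ 6 - X 0 ^ 2 - 2 * X 0 ^ 4) - X 0 ^ 4 * X 1 ^ 2 - X 0 ^ 4 :
      MvPolynomial (Fin 2) ℚ)
  simp only [torusNormSq_figureEightPoly, mem_setOf_eq, figureEightPoly_ne_zero, ne_eq,
    not_false_eq_true, true_and] at h
  simpa only [mem_univ, true_and] using h

/-- `{|1 + e(t) + e(s)|² = 0}` is null in `ℝ²`. [folklore] -/
theorem volume_boundB_eq_zero :
    volume {b : Fin 2 → ℝ | b ∈ (univ : Set (Fin 2 → ℝ)) ∧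
      (1 + (1 - b 0 ^ 2) / (1 + b 0 ^ 2) + (1 - b 1 ^ 2) / (1 + b 1 ^ 2)) ^ 2 +
        (2 * b 0 / (1 + b 0 ^ 2) + 2 * b 1 / (1 + b 1 ^ 2)) ^ 2 = 0} = 0 := by
  have h := volume_sep_torusNormSq_eq_zero (1 + X 0 + X 1 : MvPolynomial (Fin 2) ℚ)
  simp only [torusNormSq_one_add_X_add_X, mem_setOf_eq, one_add_X_add_X_ne_zero, ne_eq,
    not_false_eq_true, true_and] at h
  simpa only [mem_univ, true_and] using h

/-! ### The two representations -/

/-- **The unfolded torus representation of `M(A_{4₁})` exists**, with the item's domain and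
integrand definitionally: domain `{w | u between 1 and F(w 0, w 1)²}`, integrand
`±2/((1 + w 0²)(1 + w 1²) · w 2)`; it is the signed unfolding `KZ.logUnfoldRep` of
`h_A · log F²` over `ℝ²` (absolutely convergent: Mahler measure of `P_A`), value `4π² m(A_{4₁})`.
[Kontsevich–Zagier 2001, §1.1, eq. (4); Boyd 2002; folklore] -/
theorem exists_torusRepA :
    ∃ r : IntegralRep 3,
      r.domain = {w | (1 < w 2 ∧ w 2 < (16 * ((1 - w 0 ^ 2) / (1 + w 0 ^ 2)) ^ 4 -
        20 * ((1 - w 0 ^ 2) / (1 + w 0 ^ 2)) ^ 2 + 2 - 2 * (1 - w 1 ^ 2) / (1 + w 1 ^ 2)) ^ 2) ∨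
        ((16 * ((1 - w 0 ^ 2) / (1 + w 0 ^ 2)) ^ 4 - 20 * ((1 - w 0 ^ 2) / (1 + w 0 ^ 2)) ^ 2 + 2 -
        2 * (1 - w 1 ^ 2) / (1 + w 1 ^ 2)) ^ 2 < w 2 ∧ w 2 < 1)} ∧
      r.integrand = fun w => (if 1 < w 2 then (1:ℝ) else -1) * 2 /
        ((1 + w 0 ^ 2) * (1 + w 1 ^ 2) * w 2) := by
  set V : (Fin 2 → ℝ) → ℝ := fun b => (16 * ((1 - b 0 ^ 2) / (1 + b 0 ^ 2)) ^ 4 -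
      20 * ((1 - b 0 ^ 2) / (1 + b 0 ^ 2)) ^ 2 + 2 - 2 * (1 - b 1 ^ 2) / (1 + b 1 ^ 2)) ^ 2 with hV_def
  set h : (Fin 2 → ℝ) → ℝ := fun b => 2 / ((1 + b 0 ^ 2) * (1 + b 1 ^ 2)) with hh_def
  have hV : IsSemialgebraicFunOn ℚ univ V := isSemialgebraicFunOn_boundA isSemialgebraic_univ
  have hh : IsSemialgebraicFunOn ℚ univ h := by
    simpa [hh_def] using isSemialgebraicFunOn_weight isSemialgebraic_univ 2
  have hV0 : ∀ b ∈ (univ : Set (Fin 2 → ℝ)), 0 ≤ V b := fun b _ => sq_nonneg _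
  set R := logUnfoldRep univ V h isSemialgebraic_univ hh hV hV0 volume_boundA_eq_zero
    integrable_weightA_mul_log.integrableOn with hR
  have hdom : logUnfoldDomain univ V = {w : Fin 3 → ℝ | (1 < w 2 ∧ w 2 < (16 * ((1 - w 0 ^ 2) / (1 + w 0 ^ 2)) ^ 4 -
        20 * ((1 - w 0 ^ 2) / (1 + w 0 ^ 2)) ^ 2 + 2 - 2 * (1 - w 1 ^ 2) / (1 + w 1 ^ 2)) ^ 2) ∨
        ((16 * ((1 - w 0 ^ 2) / (1 + w 0 ^ 2)) ^ 4 - 20 * ((1 - w 0 ^ 2) / (1 + w 0 ^ 2)) ^ 2 + 2 -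
        2 * (1 - w 1 ^ 2) / (1 + w 1 ^ 2)) ^ 2 < w 2 ∧ w 2 < 1)} := by
    ext w
    simp only [mem_logUnfoldDomain, mem_univ, true_and, mem_setOf_eq, hV_def,
      show (Fin.last 2 : Fin 3) = 2 from rfl, Fin.init, Fin.castSucc_zero, Fin.castSucc_one]
  have hint : EqOn R.integrand (fun w => (if 1 < w 2 then (1:ℝ) else -1) * 2 /
      ((1 + w 0 ^ 2) * (1 + w 1 ^ 2) * w 2)) (logUnfoldDomain univ V) := by
    intro w _
    simp only [hR, integrand_logUnfoldRep, logUnfoldIntegrand, show (Fin.last 2 : Fin 3) = 2 from rfl,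
      hh_def, Fin.init, Fin.castSucc_zero, Fin.castSucc_one]
    rw [mul_div_assoc, mul_div_assoc, div_div]
  have hm : MeasurableSet (logUnfoldDomain univ V) :=
    IsSemialgebraic.measurableSet_holds (isSemialgebraic_logUnfoldDomain hV)
  refine ⟨⟨{w : Fin 3 → ℝ | _}, _, ?_, ?_, ?_⟩, rfl, rfl⟩
  · rw [← hdom]; exact isSemialgebraic_logUnfoldDomain hV
  · rw [← hdom]; exact R.isSemialgebraicFunOn_integrand.congr hint
  · rw [← hdom]; exact R.integrableOn.congr_fun hint hm

/-- **The doubled unfolded torus representation of `M(1+x+y)` exists**, with the item's domain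
and integrand definitionally: domain `{w | u between 1 and |1 + e(w 0) + e(w 1)|²}`, integrand
`±4/((1 + w 0²)(1 + w 1²) · w 2)`; it is the signed unfolding of `h_B · log |1+e(t)+e(s)|²` over
`ℝ²`, value `2 · 4π² m(1+x+y)`. [Kontsevich–Zagier 2001, §1.1, eq. (4); Smyth 1981; folklore] -/
theorem exists_torusRepB :
    ∃ r : IntegralRep 3,
      r.domain = {w | (1 < w 2 ∧ w 2 < ((1 + (1 - w 0 ^ 2) / (1 + w 0 ^ 2) +
        (1 - w 1 ^ 2) / (1 + w 1 ^ 2)) ^ 2 + (2 * w 0 / (1 + w 0 ^ 2) + 2 * w 1 / (1 + w 1 ^ 2)) ^ 2)) ∨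
        (((1 + (1 - w 0 ^ 2) / (1 + w 0 ^ 2) + (1 - w 1 ^ 2) / (1 + w 1 ^ 2)) ^ 2 +
        (2 * w 0 / (1 + w 0 ^ 2) + 2 * w 1 / (1 + w 1 ^ 2)) ^ 2) < w 2 ∧ w 2 < 1)} ∧
      r.integrand = fun w => (if 1 < w 2 then (1:ℝ) else -1) * 4 /
        ((1 + w 0 ^ 2) * (1 + w 1 ^ 2) * w 2) := by
  set V : (Fin 2 → ℝ) → ℝ := fun b => (1 + (1 - b 0 ^ 2) / (1 + b 0 ^ 2) + (1 - b 1 ^ 2) / (1 + b 1 ^ 2)) ^ 2 +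
      (2 * b 0 / (1 + b 0 ^ 2) + 2 * b 1 / (1 + b 1 ^ 2)) ^ 2 with hV_def
  set h : (Fin 2 → ℝ) → ℝ := fun b => 4 / ((1 + b 0 ^ 2) * (1 + b 1 ^ 2)) with hh_def
  have hV : IsSemialgebraicFunOn ℚ univ V := isSemialgebraicFunOn_boundB isSemialgebraic_univ
  have hh : IsSemialgebraicFunOn ℚ univ h := by
    simpa [hh_def] using isSemialgebraicFunOn_weight isSemialgebraic_univ 4
  have hV0 : ∀ b ∈ (univ : Set (Fin 2 → ℝ)), 0 ≤ V b := fun b _ => by positivity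
  set R := logUnfoldRep univ V h isSemialgebraic_univ hh hV hV0 volume_boundB_eq_zero
    integrable_weightB_mul_log.integrableOn with hR
  have hdom : logUnfoldDomain univ V = {w : Fin 3 → ℝ | (1 < w 2 ∧ w 2 < ((1 + (1 - w 0 ^ 2) / (1 + w 0 ^ 2) +
        (1 - w 1 ^ 2) / (1 + w 1 ^ 2)) ^ 2 + (2 * w 0 / (1 + w 0 ^ 2) + 2 * w 1 / (1 + w 1 ^ 2)) ^ 2)) ∨
        (((1 + (1 - w 0 ^ 2) / (1 + w 0 ^ 2) + (1 - w 1 ^ 2) / (1 + w 1 ^ 2)) ^ 2 +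
        (2 * w 0 / (1 + w 0 ^ 2) + 2 * w 1 / (1 + w 1 ^ 2)) ^ 2) < w 2 ∧ w 2 < 1)} := by
    ext w
    simp only [mem_logUnfoldDomain, mem_univ, true_and, mem_setOf_eq, hV_def,
      show (Fin.last 2 : Fin 3) = 2 from rfl, Fin.init, Fin.castSucc_zero, Fin.castSucc_one]
  have hint : EqOn R.integrand (fun w => (if 1 < w 2 then (1:ℝ) else -1) * 4 /
      ((1 + w 0 ^ 2) * (1 + w 1 ^ 2) * w 2)) (logUnfoldDomain univ V) := by
    intro w _
    simp only [hR, integrand_logUnfoldRep, logUnfoldIntegrand, show (Fin.last 2 : Fin 3) = 2 from rfl,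
      hh_def, Fin.init, Fin.castSucc_zero, Fin.castSucc_one]
    rw [mul_div_assoc, mul_div_assoc, div_div]
  have hm : MeasurableSet (logUnfoldDomain univ V) :=
    IsSemialgebraic.measurableSet_holds (isSemialgebraic_logUnfoldDomain hV)
  refine ⟨⟨{w : Fin 3 → ℝ | _}, _, ?_, ?_, ?_⟩, rfl, rfl⟩
  · rw [← hdom]; exact isSemialgebraic_logUnfoldDomain hV
  · rw [← hdom]; exact R.isSemialgebraicFunOn_integrand.congr hint
  · rw [← hdom]; exact R.integrableOn.congr_fun hint hm

end Summit.KontsevichZagierPeriods.KontsevichZagierPeriods.Theorems
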